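import Literature.AlgebraicGeometry.Resolution.ProperModelsExtension
import Literature.AlgebraicGeometry.Resolution.GraphClosureCompactification
import HarnessLib

/-!
# Extension of proper models over opens from Nagata's theorem OVER A FIELD

Topic: `Literature/AlgebraicGeometry/Resolution`. Companion to `ProperModelsExtension.lean`, which
derives the extension of proper birational modifications over opens of proper models
(`ProperModel.exists_extension_of_nagata`) from the named fact
`Literature.AlgebraicGeometry.Morphisms.NagataCompactification` (Conrad 2007, Thm. 4.1: qcqs base,
separated finite-type morphism). That use instantiates the fact only at integral schemes of finite
type over a field mapping to a proper `k`-scheme. This file shows that the ABSOLUTE statement over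
the same field `k` for INTEGRAL schemes — Nagata's original embedding theorem (Nagata 1962: every
abstract variety over a field is an open part of a complete variety), taken here as an explicit
hypothesis and not as a new named fact — already yields:

* `exists_compactification_of_nagata_over_field` — the RELATIVE compactification of a separated
  finite-type `f : Y → X`, `Y` integral, `X` separated of finite type over `k`: embed `Y ↪ Ȳ` over
  `k`, send `Y` to `Ȳ ×_k X` by `(j₀, f)` and take the scheme-theoretic image of this graph
  (`exists_graphClosure_compactification`, de Jong 1996, 4.17);
* `nagata_over_field_of_nagataCompactification` — the hypothesis is a special case of
  `NagataCompactification`;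
* `exists_isPullback_of_nagata_over_field`, `ProperModel.exists_extension_of_nagata_over_field` —
  the two theorems of `ProperModelsExtension.lean` with the weaker hypothesis.

Consequently every consumer of `ProperModel.exists_extension_of_nagata` (Zariski patching with
proper models, `ProperModelsPatchingGluing.lean`) depends on Nagata's theorem only through its
1962 field case for varieties.

## References

* M. Nagata, *Imbedding of an abstract variety in a complete variety*, J. Math. Kyoto Univ. 2
  (1962) 1–10. [Nagata1962]
* B. Conrad, *Deligne's notes on Nagata compactifications*, J. Ramanujan Math. Soc. 22 (2007),
  Thm. 4.1. [Conrad2007]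
* A. J. de Jong, *Smoothness, semi-stability and alterations*, Publ. Math. IHÉS 83 (1996), 4.17
  (closure of the graph). [DeJong1996]
-/

noncomputable section

open CategoryTheory CategoryTheory.Limits AlgebraicGeometry TopologicalSpace Topology
open Literature.AlgebraicGeometry.Morphisms

namespace Literature.AlgebraicGeometry.Resolution

universe u

/-- **Relative compactification over a `k`-base from Nagata's theorem over the field `k`**
(closure of the graph): assume every integral separated `k`-scheme of finite type embeds as an
open subscheme of a proper `k`-scheme (Nagata 1962). Then every separated finite-type morphism
`f : Y → X` from an integral `Y` to a separated finite-type `k`-scheme `X` factors as an open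
immersion `j : Y → X̄` followed by a proper `g : X̄ → X`: take `Y ↪ Ȳ` over `k`, the graph
`(j₀, f) : Y → Ȳ ×_k X` and its scheme-theoretic image (`exists_graphClosure_compactification`).
[folklore] -/
theorem exists_compactification_of_nagata_over_field {k : Type u} [Field k]
    (hN : ∀ (Y : Scheme.{u}) [IsIntegral Y] (f : Y ⟶ Spec (.of k)) [IsSeparated f]
      [LocallyOfFiniteType f] [QuasiCompact f],
      ∃ (Yc : Scheme.{u}) (j : Y ⟶ Yc) (g : Yc ⟶ Spec (.of k)),
        IsOpenImmersion j ∧ IsProper g ∧ j ≫ g = f)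
    {X Y : Scheme.{u}} [IsIntegral Y] (πX : X ⟶ Spec (.of k))
    [IsSeparated πX] [LocallyOfFiniteType πX] [QuasiCompact πX]
    (f : Y ⟶ X) [IsSeparated f] [LocallyOfFiniteType f] [QuasiCompact f] :
    ∃ (Xc : Scheme.{u}) (j : Y ⟶ Xc) (g : Xc ⟶ X), IsOpenImmersion j ∧ IsProper g ∧ j ≫ g = f := by
  -- compactify `Y` over `k`
  obtain ⟨N, j₀, gN, hj₀, hgN, hfac⟩ := hN Y (f ≫ πX)
  haveI := hj₀
  haveI := hgN
  -- `Y` is Noetherian, so every morphism out of it is quasi-compact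
  haveI : IsLocallyNoetherian Y := LocallyOfFiniteType.isLocallyNoetherian (f ≫ πX)
  haveI : CompactSpace Y := QuasiCompact.compactSpace_of_compactSpace (f ≫ πX)
  haveI : IsNoetherian Y := {}
  -- the graph of `f` inside `N ×_k X`, and its closure
  let γ : Y ⟶ pullback gN πX := pullback.lift j₀ f hfac
  have hγ : γ ≫ pullback.fst gN πX = j₀ := pullback.lift_fst _ _ _
  obtain ⟨Y', c, s, -, hc, hsc, hs, -, -⟩ :=
    exists_graphClosure_compactification j₀ (pullback.fst gN πX) γ hγ
  haveI := hc
  refine ⟨Y', s, c ≫ pullback.snd gN πX, hs, inferInstance, ?_⟩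
  rw [← Category.assoc, hsc]
  exact pullback.lift_snd _ _ _

/-- The field hypothesis of `exists_compactification_of_nagata_over_field` is the special case
`S = Spec k`, `X` integral of the named fact `NagataCompactification` (Conrad 2007, Thm. 4.1).
[folklore] -/
theorem nagata_over_field_of_nagataCompactification (h : NagataCompactification.{u})
    (k : Type u) [Field k] :
    ∀ (Y : Scheme.{u}) [IsIntegral Y] (f : Y ⟶ Spec (.of k)) [IsSeparated f]
      [LocallyOfFiniteType f] [QuasiCompact f],
      ∃ (Yc : Scheme.{u}) (j : Y ⟶ Yc) (g : Yc ⟶ Spec (.of k)),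
        IsOpenImmersion j ∧ IsProper g ∧ j ≫ g = f := by
  intro Y _ f _ _ _
  haveI : QuasiSeparatedSpace (Spec (CommRingCat.of k)) :=
    inferInstanceAs (QuasiSeparatedSpace (Spec (CommRingCat.of k)))
  exact h Y (Spec (.of k)) f

/-- **Proper integral extension over a separated finite-type `k`-base of a proper scheme over an
open, from Nagata over the field** (`exists_isPullback_of_nagata` with the weaker hypothesis): for
`X` separated of finite type over `k`, `U ⊆ X` open, `Y` integral and `g : Y → U` proper there are
an integral `Z`, a proper `ρ : Z → X` and a dense open immersion `s : Y → Z` with `Y = ρ⁻¹(U)`.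
[folklore] -/
theorem exists_isPullback_of_nagata_over_field {k : Type u} [Field k]
    (hN : ∀ (Y : Scheme.{u}) [IsIntegral Y] (f : Y ⟶ Spec (.of k)) [IsSeparated f]
      [LocallyOfFiniteType f] [QuasiCompact f],
      ∃ (Yc : Scheme.{u}) (j : Y ⟶ Yc) (g : Yc ⟶ Spec (.of k)),
        IsOpenImmersion j ∧ IsProper g ∧ j ≫ g = f)
    {X : Scheme.{u}} (πX : X ⟶ Spec (.of k))
    [IsSeparated πX] [LocallyOfFiniteType πX] [QuasiCompact πX]
    (U : X.Opens) {Y : Scheme.{u}} [IsIntegral Y] (g : Y ⟶ (U : Scheme.{u})) [IsProper g] :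
    ∃ (Z : Scheme.{u}) (ρ : Z ⟶ X) (s : Y ⟶ Z), IsIntegral Z ∧ IsProper ρ ∧
      IsOpenImmersion s ∧ Dense (Set.range s) ∧ IsPullback s g ρ U.ι := by
  haveI : IsLocallyNoetherian X := LocallyOfFiniteType.isLocallyNoetherian πX
  obtain ⟨Xc, j, gc, hj, hgc, hfac⟩ :=
    exists_compactification_of_nagata_over_field hN πX (g ≫ U.ι)
  haveI := hj
  haveI := hgc
  haveI : IsLocallyNoetherian Xc := LocallyOfFiniteType.isLocallyNoetherian gc
  obtain ⟨Z, c, s, hZ, hc, hsc, hs, hdense, -⟩ :=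
    exists_graphClosure_compactification j (𝟙 Xc) j (Category.comp_id j)
  haveI := hZ
  haveI := hc
  haveI := hs
  have hsρ : s ≫ c ≫ gc = g ≫ U.ι := by rw [← Category.assoc, hsc, hfac]
  exact ⟨Z, c ≫ gc, s, hZ, inferInstance, hs, hdense,
    isPullback_of_isOpenImmersion_of_universallyClosed s g (c ≫ gc) U.ι hsρ⟩

namespace ProperModel

/-- **Extension of proper birational modifications over opens of proper models, from Nagata over
the field** (`ProperModel.exists_extension_of_nagata` with the weaker hypothesis; Piltant 2013,
proof of Prop. 5.1, Step 5): for a proper model `P` of `K/k`, an open `U ⊆ P`, an integral `Y` and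
a proper birational `g : Y → U` there are a proper model `P' → P` and an open immersion `Y → P'`
with `Y = P' ×_P U`. [folklore] -/
theorem exists_extension_of_nagata_over_field {k K : Type u} [Field k] [Field K] [Algebra k K]
    (hN : ∀ (Y : Scheme.{u}) [IsIntegral Y] (f : Y ⟶ Spec (.of k)) [IsSeparated f]
      [LocallyOfFiniteType f] [QuasiCompact f],
      ∃ (Yc : Scheme.{u}) (j : Y ⟶ Yc) (g : Yc ⟶ Spec (.of k)),
        IsOpenImmersion j ∧ IsProper g ∧ j ≫ g = f)
    (P : ProperModel k K) (U : P.X.Opens) (Y : Scheme.{u}) [IsIntegral Y]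
    (g : Y ⟶ (U : Scheme.{u})) [IsProper g] (hg : IsBirational g) :
    ∃ (P' : ProperModel k K) (φ : P'.Hom P) (i : Y ⟶ P'.X), IsOpenImmersion i ∧
      IsPullback i g φ.f U.ι := by
  haveI : IsProper P.π := P.isProper
  obtain ⟨Z, ρ, s, hZ, hρ, hs, -, hsq⟩ := exists_isPullback_of_nagata_over_field hN P.π U g
  haveI := hZ
  haveI := hρ
  haveI := hs
  obtain ⟨O, hOd, -, hO⟩ := hg
  haveI := hO
  haveI : Nonempty (U : Scheme.{u}) := ⟨g.base (Classical.arbitrary Y)⟩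
  have hne : (U.ι ''ᵁ O : Set P.X).Nonempty := nonempty_image_ι U hOd.nonempty
  haveI : IsIso (ρ ∣_ (U.ι ''ᵁ O)) := isIso_morphismRestrict_image_of_isPullback hsq O
  exact ⟨ofModification P ρ (U.ι ''ᵁ O) hne, ofModificationHom P ρ (U.ι ''ᵁ O) hne, s, hs, hsq⟩

end ProperModel

end Literature.AlgebraicGeometry.Resolution

end
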